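import Literature.GroupTheory.CombinatorialGroupTheory.RandomSclFreeGroupProofs
import HarnessLib

/-!
# Random rigidity of scl (Calegari–Walker 2013): proofs, part 9 — an upper bound for `cl` from matched chunks

D. Calegari, A. Walker, *Random rigidity in the free group*, Geom. Topol. 17 (2013)
[CalegariWalker2013], §3–§4: an admissible surface for `v` is built from long matched pairs of
subwords (`σ` somewhere, `σ⁻¹` elsewhere) — the edges of a fatgraph — the remaining letters being
matched arbitrarily (Lemma 3.5, Culler; §4.3). The fewer and longer the edges, the smaller
`−χ`, hence `cl` and `scl`.

Here is the DETERMINISTIC letter-level form of this certificate, dual to part 6: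

* **`exists_isPairing_extension`** — a partial pairing of a balanced word (a letter-inverting
  fixed-point-free involution on a set `S` of positions) extends to a pairing of the whole word.
* **`orbitCount_ge_of_twoCycles`** — a permutation with `m` points `x` in a set `X` with
  `τ² x = x`, `τ x ∉ X` (so no two in the same orbit) has `≥ m` orbits.
* **`commutatorLength_le_of_matchedChunks`** — if a balanced word `W` of length `n` contains `M`
  disjoint matched chunk pairs of length `ℓ + 1` (`W[y_r + ℓ − q] = W[x_r + q]⁻¹`), then
  `4 cl(W) + 2 ℓ M ≤ n + 2`.
-/

noncomputable section

namespace Literature.GroupTheory.CombinatorialGroupTheory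

section Extension

open Equiv

/-- **Extension of partial pairings.** Let `W` be a word whose letters are balanced
(`#(a, true) = #(a, false)` for every `a`, i.e. `mk W ∈ [F, F]`), `S` a set of positions and
`p : Fin |W| → Fin |W|` a map which on `S` is a letter-inverting fixed-point-free involution
preserving `S`. Then there is a pairing of `W` agreeing with `p` on `S`. [folklore] -/
theorem exists_isPairing_extension {α : Type*} [DecidableEq α] (W : List (α × Bool))
    (hW : FreeGroup.mk W ∈ commutator (FreeGroup α)) (S : Finset (Fin W.length))
    (p : Fin W.length → Fin W.length) (hpS : ∀ x ∈ S, p x ∈ S) (hpp : ∀ x ∈ S, p (p x) = x)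
    (hpne : ∀ x ∈ S, p x ≠ x)
    (hpl : ∀ x ∈ S, W.get (p x) = ((W.get x).1, !(W.get x).2)) :
    ∃ π : Equiv.Perm (Fin W.length), IsPairing W π ∧ ∀ x ∈ S, π x = p x := by
  classical
  -- the leftover positions, in increasing order
  set R : Finset (Fin W.length) := Finset.univ \ S with hR
  set e := R.orderIsoOfFin rfl with he
  -- the leftover word
  set WR : List (α × Bool) := List.ofFn fun i : Fin R.card => W.get (e i) with hWR
  -- it is balanced
  have hcountW : ∀ a, W.count (a, true) = W.count (a, false) := (mk_mem_commutator_iff_count W).mp hW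
  have hbalS : ∀ a, (S.filter fun x => W.get x = (a, true)).card =
      (S.filter fun x => W.get x = (a, false)).card := by
    intro a
    refine Finset.card_bij (fun x _ => p x) ?_ ?_ ?_
    · intro x hx
      rw [Finset.mem_filter] at hx ⊢
      refine ⟨hpS x hx.1, ?_⟩
      rw [hpl x hx.1, hx.2]
      rfl
    · intro x hx y hy hxy
      rw [Finset.mem_filter] at hx hy
      rw [← hpp x hx.1, ← hpp y hy.1, hxy]
    · intro y hy
      rw [Finset.mem_filter] at hy
      refine ⟨p y, Finset.mem_filter.mpr ⟨hpS y hy.1, ?_⟩, hpp y hy.1⟩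
      rw [hpl y hy.1, hy.2]
      rfl
  have hbalR : ∀ a, (R.filter fun x => W.get x = (a, true)).card =
      (R.filter fun x => W.get x = (a, false)).card := by
    intro a
    have htot : ∀ b, (Finset.univ.filter fun x : Fin W.length => W.get x = (a, b)).card =
        (S.filter fun x => W.get x = (a, b)).card + (R.filter fun x => W.get x = (a, b)).card := by
      intro b
      rw [hR, ← Finset.card_union_of_disjoint (Finset.disjoint_filter_filter
        Finset.sdiff_disjoint.symm), ← Finset.filter_union, Finset.union_sdiff_of_subset
        (Finset.subset_univ S)]
    have h1 := card_filter_get_eq_count W (a, true)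
    have h2 := card_filter_get_eq_count W (a, false)
    have := hcountW a
    have e1 := htot true
    have e2 := htot false
    have := hbalS a
    omega
  have hWRcomm : FreeGroup.mk WR ∈ commutator (FreeGroup α) := by
    rw [mk_mem_commutator_iff_count]
    intro a
    rw [hWR, count_ofFn, count_ofFn]
    have hfib : ∀ b, (Finset.univ.filter fun i : Fin R.card => W.get (e i) = (a, b)).card =
        (R.filter fun x => W.get x = (a, b)).card := by
      intro b
      refine Finset.card_bij (fun i _ => (e i : Fin W.length)) ?_ ?_ ?_
      · intro i hi
        rw [Finset.mem_filter] at hi ⊢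
        exact ⟨(e i).2, hi.2⟩
      · intro i _ j _ h
        exact e.injective (Subtype.ext h)
      · intro x hx
        rw [Finset.mem_filter] at hx
        refine ⟨e.symm ⟨x, hx.1⟩, Finset.mem_filter.mpr ⟨Finset.mem_univ _, ?_⟩, ?_⟩
        · rw [OrderIso.apply_symm_apply]; exact hx.2
        · rw [OrderIso.apply_symm_apply]
    rw [hfib, hfib]
    exact hbalR a
  -- a pairing of the leftover word
  obtain ⟨πR, hπR⟩ := exists_isPairing_of_mk_mem_commutator WR hWRcomm
  have hlenR : WR.length = R.card := by rw [hWR, List.length_ofFn]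
  -- transport it to the leftover positions
  have hmemR : ∀ x, x ∉ S → x ∈ R := fun x hx => by
    rw [hR, Finset.mem_sdiff]; exact ⟨Finset.mem_univ _, hx⟩
  have heR : ∀ i, ((e i : Fin W.length)) ∉ S := fun i => by
    have h2 := Finset.mem_sdiff.mp (e i).2
    exact h2.2
  let castR : Fin R.card → Fin WR.length := fun i => ⟨i, by rw [hlenR]; exact i.isLt⟩
  let castR' : Fin WR.length → Fin R.card := fun i => ⟨i, by rw [← hlenR]; exact i.isLt⟩
  have hcast : ∀ i, castR (castR' i) = i := fun i => Fin.ext rfl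
  have hcast' : ∀ i, castR' (castR i) = i := fun i => Fin.ext rfl
  -- the partner of a leftover position
  let g : ∀ x : Fin W.length, x ∉ S → Fin W.length := fun x hx =>
    (e (castR' (πR (castR (e.symm ⟨x, hmemR x hx⟩)))) : Fin W.length)
  have hgS : ∀ x hx, g x hx ∉ S := fun x hx => heR _
  have hgg : ∀ x hx, g (g x hx) (hgS x hx) = x := by
    intro x hx
    simp only [g]
    have e1 : (⟨(e (castR' (πR (castR (e.symm ⟨x, hmemR x hx⟩)))) : Fin W.length),
        hmemR _ (heR _)⟩ : R) = e (castR' (πR (castR (e.symm ⟨x, hmemR x hx⟩)))) :=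
      Subtype.ext rfl
    rw [e1, OrderIso.symm_apply_apply, hcast, hπR.1, hcast', OrderIso.apply_symm_apply]
  have hgne : ∀ x hx, g x hx ≠ x := by
    intro x hx h
    simp only [g] at h
    set j := e.symm ⟨x, hmemR x hx⟩ with hj
    have h1 : e (castR' (πR (castR j))) = e j := by
      rw [hj, OrderIso.apply_symm_apply]
      exact Subtype.ext h
    have h2 : castR' (πR (castR j)) = j := e.injective h1
    have h3 : πR (castR j) = castR j := by
      rw [← hcast (πR (castR j)), h2]
    exact hπR.2.1 _ h3
  have hWRget : ∀ i : Fin WR.length, WR.get i = W.get (e (castR' i)) := by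
    intro i
    simp only [hWR, List.get_eq_getElem, List.getElem_ofFn, castR']
  have hgl : ∀ x hx, W.get (g x hx) = ((W.get x).1, !(W.get x).2) := by
    intro x hx
    simp only [g]
    have h := hπR.2.2 (castR (e.symm ⟨x, hmemR x hx⟩))
    rw [hWRget, hWRget, hcast', OrderIso.apply_symm_apply] at h
    exact h
  -- the full map
  let f : Fin W.length → Fin W.length := fun x => if hx : x ∈ S then p x else g x hx
  have hfS : ∀ x ∈ S, f x = p x := fun x hx => by simp only [f, dif_pos hx]
  have hfR : ∀ x (hx : x ∉ S), f x = g x hx := fun x hx => by simp only [f, dif_neg hx]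
  have hinv : Function.Involutive f := by
    intro x
    by_cases hx : x ∈ S
    · rw [hfS x hx, hfS _ (hpS x hx), hpp x hx]
    · rw [hfR x hx, hfR _ (hgS x hx), hgg x hx]
  refine ⟨hinv.toPerm f, ⟨fun x => hinv x, fun x => ?_, fun x => ?_⟩, hfS⟩
  · -- no fixed points
    change f x ≠ x
    by_cases hx : x ∈ S
    · rw [hfS x hx]; exact hpne x hx
    · rw [hfR x hx]; exact hgne x hx
  · -- letters
    change W.get (f x) = _
    by_cases hx : x ∈ S
    · rw [hfS x hx]; exact hpl x hx
    · rw [hfR x hx]; exact hgl x hx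

end Extension

section OrbitLower

open Equiv

/-- **Orbits from 2-cycles.** Let `τ` be a permutation of `Fin N` and `X` a set of points with
`τ (τ x) = x` and `τ x ∉ X` for `x ∈ X`. Then `τ` has at least `#X` orbits. [folklore] -/
theorem orbitCount_ge_of_twoCycles {N : ℕ} (τ : Equiv.Perm (Fin N))
    (X : Finset (Fin N)) (hX : ∀ x ∈ X, τ (τ x) = x) (hX' : ∀ x ∈ X, τ x ∉ X) :
    X.card ≤ orbitCount τ := by
  classical
  rw [← card_image_cycleLabel τ]
  have hXne : ∀ x ∈ X, τ x ≠ x := fun x hx h => hX' x hx (h.symm ▸ hx)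
  -- powers of `τ` on a 2-cycle
  have hpow : ∀ x ∈ X, ∀ i : ℕ, (τ ^ i) x = x ∨ (τ ^ i) x = τ x := by
    intro x hx i
    induction i with
    | zero => left; simp
    | succ i ih =>
      rw [pow_succ', Equiv.Perm.mul_apply]
      rcases ih with h | h
      · right; rw [h]
      · left; rw [h, hX x hx]
  refine le_trans ?_ (Finset.card_le_card (Finset.image_subset_image (Finset.subset_univ X)))
  rw [Finset.card_image_of_injOn]
  intro x hx x' hx' h
  rw [Finset.mem_coe] at hx hx'
  simp only [Prod.mk.injEq] at h
  have hx'ne : τ x' ≠ x' := by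
    intro h'
    have h2 := h.2
    rw [if_neg (hXne x hx), if_pos h'] at h2
    exact Option.some_ne_none x' h2.symm
  have hsame : τ.SameCycle x x' := by
    have hmem : x' ∈ (τ.cycleOf x').support := by
      rw [Equiv.Perm.mem_support, Equiv.Perm.cycleOf_apply_self]
      exact hx'ne
    rw [← h.1, Equiv.Perm.mem_support_cycleOf_iff] at hmem
    exact hmem.1
  obtain ⟨i, _, hi⟩ := hsame.exists_pow_eq'
  rcases hpow x hx i with h0 | h1
  · rw [← hi, h0]
  · exfalso
    rw [h1] at hi
    exact hX' x hx (hi ▸ hx')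

end OrbitLower

section MatchedChunks

open Equiv

/-- **An upper bound for `cl` from matched chunks (CW Lemma 3.5 / §4.3, letter level).** Let `W`
be a balanced word and `P : Fin M × Fin (ℓ+1) × Bool ↪ Fin |W|` an injective family of positions,
consecutive within each chunk (`P (r, q, b) = P (r, 0, b) + q`), such that the chunk `(r, true)`
read backwards is the inverse of the chunk `(r, false)`: `W[P(r, ℓ−q, true)] = W[P(r, q, false)]⁻¹`.
Then `4 · cl(W) + 2 ℓ M ≤ |W| + 2`: pair the chunks letterwise, extend to a pairing of `W`
(`exists_isPairing_extension`); each matched pair contributes `ℓ` two-element orbits of the vertex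
permutation (`orbitCount_ge_of_twoCycles`), and `4 cl + 2 orb ≤ |W| + 2`
(`commutatorLength_le_of_isPairing`). [cite: CalegariWalker2013, Lemma 3.5 and §4.3] -/
theorem commutatorLength_le_of_matchedChunks {α : Type*} [DecidableEq α] (W : List (α × Bool))
    (hW : FreeGroup.mk W ∈ commutator (FreeGroup α)) (ℓ M : ℕ)
    (P : Fin M × Fin (ℓ + 1) × Bool → Fin W.length) (hP : Function.Injective P)
    (hPq : ∀ r q b, ((P (r, q, b) : Fin W.length) : ℕ) = (P (r, 0, b) : ℕ) + q)
    (hinv : ∀ r (q : Fin (ℓ + 1)), W.get (P (r, ⟨ℓ - q, by omega⟩, true)) =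
      ((W.get (P (r, q, false))).1, !(W.get (P (r, q, false))).2)) :
    4 * commutatorLength (FreeGroup.mk W) + 2 * ℓ * M ≤ W.length + 2 := by
  classical
  -- the partner map on the chunks
  let swap : Fin M × Fin (ℓ + 1) × Bool → Fin M × Fin (ℓ + 1) × Bool :=
    fun t => (t.1, ⟨ℓ - t.2.1, by omega⟩, !t.2.2)
  have hswap2 : ∀ t, swap (swap t) = t := by
    rintro ⟨r, q, b⟩
    simp only [swap, Bool.not_not, Prod.mk.injEq, true_and]
    exact ⟨Fin.ext (by simp only; omega), trivial⟩
  have hswapne : ∀ t, swap t ≠ t := by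
    rintro ⟨r, q, b⟩ h
    simp only [swap, Prod.mk.injEq] at h
    exact Bool.not_ne_self b h.2.2
  have hinv' : ∀ t, W.get (P (swap t)) = ((W.get (P t)).1, !(W.get (P t)).2) := by
    rintro ⟨r, q, b⟩
    cases b
    · exact hinv r q
    · simp only [swap, Bool.not_true]
      have h := hinv r ⟨ℓ - q, by omega⟩
      have e : (⟨ℓ - (ℓ - (q : ℕ)), by omega⟩ : Fin (ℓ + 1)) = q := Fin.ext (by simp only; omega)
      simp only [e] at h
      rw [h]
      simp
  set S : Finset (Fin W.length) := Finset.univ.image P with hS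
  let p : Fin W.length → Fin W.length := fun x =>
    if h : ∃ t, P t = x then P (swap h.choose) else x
  have hpP : ∀ t, p (P t) = P (swap t) := by
    intro t
    have h : ∃ t', P t' = P t := ⟨t, rfl⟩
    simp only [p, dif_pos h]
    rw [hP h.choose_spec]
  have hmemS : ∀ x, x ∈ S ↔ ∃ t, P t = x := fun x => by
    rw [hS, Finset.mem_image]; simp
  obtain ⟨π, hπ, hπS⟩ := exists_isPairing_extension W hW S p
    (fun x hx => by
      obtain ⟨t, rfl⟩ := (hmemS x).mp hx
      rw [hpP]; exact (hmemS _).mpr ⟨swap t, rfl⟩)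
    (fun x hx => by
      obtain ⟨t, rfl⟩ := (hmemS x).mp hx
      rw [hpP, hpP, hswap2])
    (fun x hx => by
      obtain ⟨t, rfl⟩ := (hmemS x).mp hx
      rw [hpP]; exact fun h => hswapne t (hP h))
    (fun x hx => by
      obtain ⟨t, rfl⟩ := (hmemS x).mp hx
      rw [hpP]; exact hinv' t)
  have hπP : ∀ t, π (P t) = P (swap t) := fun t => by
    rw [hπS _ ((hmemS _).mpr ⟨t, rfl⟩), hpP]
  -- the vertex permutation and its 2-cycles
  have hn : 0 < W.length ∨ M = 0 ∨ ℓ = 0 := by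
    rcases Nat.eq_zero_or_pos W.length with h | h
    · rcases Nat.eq_zero_or_pos M with hM | hM
      · exact Or.inr (Or.inl hM)
      · exact absurd (P (⟨0, hM⟩, 0, false)).isLt (by omega)
    · exact Or.inl h
  set τ : Equiv.Perm (Fin W.length) := (finRotate W.length).trans π with hτ
  have hmain := commutatorLength_le_of_isPairing W π hπ
  rcases hn with hn | hM | hℓ
  · -- `fr (P (r, q, b)) = P (r, q+1, b)` inside a chunk
    have hfr : ∀ r (q : Fin (ℓ + 1)) b (hq : (q : ℕ) + 1 < ℓ + 1),
        finRotate W.length (P (r, q, b)) = P (r, ⟨q + 1, hq⟩, b) := by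
      intro r q b hq
      apply Fin.ext
      rw [val_finRotate hn, hPq r ⟨q + 1, hq⟩ b, hPq r q b]
      have := (P (r, ⟨q + 1, hq⟩, b)).isLt
      rw [hPq r ⟨q + 1, hq⟩ b] at this
      simp only at this ⊢
      rw [Nat.mod_eq_of_lt (by omega)]
      omega
    have hτP : ∀ r (q q' : Fin (ℓ + 1)) b, (q : ℕ) + 1 ≤ ℓ → (q' : ℕ) = ℓ - (q + 1) →
        τ (P (r, q, b)) = P (r, q', !b) := by
      intro r q q' b hq hq'
      have hq1 : (q : ℕ) + 1 < ℓ + 1 := by omega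
      rw [hτ, Equiv.trans_apply, hfr r q b hq1, hπP]
      show P (r, ⟨ℓ - ((q : ℕ) + 1), _⟩, !b) = P (r, q', !b)
      congr 3
      exact Fin.ext (show ℓ - ((q : ℕ) + 1) = (q' : ℕ) by omega)
    set X : Finset (Fin W.length) := (Finset.univ : Finset (Fin M × Fin ℓ)).image
      fun rq => P (rq.1, rq.2.castSucc, false) with hX
    have hXcard : X.card = ℓ * M := by
      rw [hX, Finset.card_image_of_injective, Finset.card_univ, Fintype.card_prod,
        Fintype.card_fin, Fintype.card_fin, mul_comm]
      intro rq rq' h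
      have h' := hP h
      simp only [Prod.mk.injEq, Fin.castSucc_inj] at h'
      exact Prod.ext h'.1 h'.2.1
    have hX2 : ∀ x ∈ X, τ (τ x) = x := by
      intro x hx
      rw [hX, Finset.mem_image] at hx
      obtain ⟨⟨r, q⟩, _, rfl⟩ := hx
      have hq := q.isLt
      have hqc : ((q.castSucc : Fin (ℓ + 1)) : ℕ) = q := Fin.val_castSucc q
      rw [hτP r q.castSucc ⟨ℓ - (q + 1), by omega⟩ false (by rw [hqc]; omega)
        (by rw [hqc]), hτP r ⟨ℓ - (q + 1), by omega⟩ q.castSucc (!false) (by simp only; omega)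
        (by rw [hqc]; simp only; omega)]
      simp
    have hX' : ∀ x ∈ X, τ x ∉ X := by
      intro x hx hτx
      rw [hX, Finset.mem_image] at hx hτx
      obtain ⟨⟨r, q⟩, _, rfl⟩ := hx
      obtain ⟨⟨r', q'⟩, _, h⟩ := hτx
      have hq := q.isLt
      have hqc : ((q.castSucc : Fin (ℓ + 1)) : ℕ) = q := Fin.val_castSucc q
      rw [hτP r q.castSucc ⟨ℓ - (q + 1), by omega⟩ false (by rw [hqc]; omega) (by rw [hqc])] at h
      have h' := hP h
      simp only [Prod.mk.injEq, Bool.not_false] at h'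
      exact Bool.false_ne_true h'.2.2
    have horb := orbitCount_ge_of_twoCycles τ X hX2 hX'
    rw [hXcard] at horb
    have hmain' : 4 * commutatorLength (FreeGroup.mk W) + 2 * orbitCount τ ≤ W.length + 2 := hmain
    have e2 : 2 * ℓ * M = 2 * (ℓ * M) := by ring
    omega
  · subst hM; omega
  · subst hℓ; omega

end MatchedChunks


end Literature.GroupTheory.CombinatorialGroupTheory

end
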